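import Mathlib.Order.WithBot
import Literature.Combinatorics.SimpleGraph.ColourRefinementOrder
import Literature.Computability.Complexity.IndividualizationRefinement
import HarnessLib

/-!
# Ordered colour refinement is label-invariant: the plain individualization–refinement scheme (McKay–Piperno 2014, §3)

The standard ingredients of individualization–refinement algorithms as a CONCRETE instance of
`IRScheme` (`IndividualizationRefinement.lean`), machine-free, on top of the tree's ORDERED
COLOUR REFINEMENT (`Literature/Combinatorics/SimpleGraph/ColourRefinementOrder.lean`: the
competition rank `rankOf`, neighbour counts `nbrCount`, the key order `KeyLT`, one round
`ocrStep G col`):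

* LABEL-INVARIANCE of that round under relabelling along `e : Fin k ≃ Fin k` (pullback form,
  `G.comap e`, `col ∘ e`): `rankOf_comp_equiv`, `nbrCount_comap`, `profLT_comap`, `keyLT_comap`,
  **`ocrStep_comap : ocrStep (G.comap e) (col ∘ e) = ocrStep G col ∘ e`** — the content of
  "implemented in a label-invariant manner" ([MP14, §3.1]; (R3));
* `colourRefine G π` — `k` rounds from the rank-normalised colouring; `individualize π v` (`v` gets
  the least colour); `refineSeq G π ν` — the refinement FUNCTION `R(G, π, ν)` of [MP14, §2.3]
  (refine; along `ν`, individualize and refine); all label-invariant (`refineSeq_comap`);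
* singleton cells persist (`isSingletonColour_refineSeq`: the vertices of `ν` are singleton cells
  of `R(G, π, ν)`, (R2) of [MP14]);
* `targetOf ρ` — the least-coloured non-singleton cell (empty iff `ρ` is discrete; [MP14, §3.2]),
  label-invariant (`targetOf_comp`);
* **`crScheme k : IRScheme k`** with all four laws proved, hence (`crScheme_isLabelingSet`) the
  leaf labelings of the textbook search tree form a nonempty, equivariant labeling set.

This tree is NOT of simply-exponential size in general; simply-exponential canonisers
(Corneil–Goldberg 1984) replace its selector/branching. Not here: (R1), equitability and
stabilisation (`ColourRefinement(Canonical).lean` have them for the uniform start), pruning,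
node invariants, machines.

## References

* B. D. McKay, A. Piperno, *Practical graph isomorphism, II*, J. Symbolic Comput. 60 (2014) 94–112,
  arXiv:1301.1493, §2.3 ((R1)–(R3), (T1)–(T3)), §3.1 (refinement "in a label-invariant manner"),
  §3.2 (target cells). [MckayPiperno2014]
* J.-Y. Cai, M. Fürer, N. Immerman, Combinatorica 12 (1992), §5 (vertex refinement with sorted
  integer colours). [CaiFurerImmerman1992]
-/

namespace Literature.Computability.Complexity

open _root_.Computability Literature.Combinatorics.SimpleGraph

open scoped Classical

namespace ColourRefinementScheme

variable {k : ℕ}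

/-! ### Label-invariance of one ordered refinement round -/

/-- **Competition ranks are label-invariant**: `rankOf (f ∘ e) = rankOf f ∘ e`. [cite: MckayPiperno2014, §3.1] -/
theorem rankOf_comp_equiv {α : Type} [LinearOrder α] (f : Fin k → α) (e : Equiv.Perm (Fin k)) :
    rankOf (f ∘ e) = rankOf f ∘ e := by
  funext u
  unfold rankOf
  exact Finset.card_equiv e fun v => by simp

/-- Neighbour counts are label-invariant. [folklore] -/
theorem nbrCount_comap (G : SimpleGraph (Fin k)) (e : Equiv.Perm (Fin k)) [DecidableRel G.Adj]
    [DecidableRel (G.comap e).Adj] (col : Fin k → ℕ) (u : Fin k) (c : ℕ) :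
    nbrCount (G.comap e) (col ∘ e) u c = nbrCount G col (e u) c := by
  unfold nbrCount
  exact Finset.card_equiv e fun w => by simp [SimpleGraph.comap_adj]

/-- The profile comparison is label-invariant. [folklore] -/
theorem profLT_comap (G : SimpleGraph (Fin k)) (e : Equiv.Perm (Fin k)) [DecidableRel G.Adj]
    [DecidableRel (G.comap e).Adj] (col : Fin k → ℕ) (u v : Fin k) :
    ProfLT (G.comap e) (col ∘ e) u v ↔ ProfLT G col (e u) (e v) := by
  unfold ProfLT
  simp only [nbrCount_comap, Function.comp_apply]
  constructor
  · rintro ⟨w, h₁, h₂⟩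
    exact ⟨e w, h₁, fun w' hw' => by simpa using h₂ (e.symm w') (by simpa using hw')⟩
  · rintro ⟨w, h₁, h₂⟩
    exact ⟨e.symm w, by simpa using h₁, fun w' hw' => h₂ (e w') (by simpa using hw')⟩

/-- The key order is label-invariant. [folklore] -/
theorem keyLT_comap (G : SimpleGraph (Fin k)) (e : Equiv.Perm (Fin k)) [DecidableRel G.Adj]
    [DecidableRel (G.comap e).Adj] (col : Fin k → ℕ) (u v : Fin k) :
    KeyLT (G.comap e) (col ∘ e) u v ↔ KeyLT G col (e u) (e v) := by
  unfold KeyLT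
  rw [profLT_comap]
  rfl

/-- **One round of ordered colour refinement is label-invariant**:
`ocrStep (G.comap e) (col ∘ e) = ocrStep G col ∘ e`. [cite: MckayPiperno2014, §3.1 ((R3) for the refinement)] -/
theorem ocrStep_comap (G : SimpleGraph (Fin k)) (e : Equiv.Perm (Fin k)) [DecidableRel G.Adj]
    [DecidableRel (G.comap e).Adj] (col : Fin k → ℕ) :
    ocrStep (G.comap e) (col ∘ e) = ocrStep G col ∘ e := by
  funext u
  unfold ocrStep
  exact Finset.card_equiv e fun v => by simp [keyLT_comap]

/-! ### Colour refinement from a colouring, individualization, `R(G, π, ν)` -/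

/-- One round, with the adjacency decided classically (so that no instance is carried around).
[cite: MckayPiperno2014, §3.1] -/
noncomputable def crStep (G : SimpleGraph (Fin k)) (col : Fin k → ℕ) : Fin k → ℕ := ocrStep G col

/-- `crStep` is label-invariant. [cite: MckayPiperno2014, §3.1] -/
theorem crStep_comap (G : SimpleGraph (Fin k)) (col : Fin k → ℕ) (e : Equiv.Perm (Fin k)) :
    crStep (G.comap e) (col ∘ e) = crStep G col ∘ e :=
  ocrStep_comap G e col

/-- Iterated rounds are label-invariant. [folklore] -/
theorem crStep_iterate_comap (G : SimpleGraph (Fin k)) (e : Equiv.Perm (Fin k)) :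
    ∀ (n : ℕ) (ρ : Fin k → ℕ), (crStep (G.comap e))^[n] (ρ ∘ e) = (crStep G)^[n] ρ ∘ e
  | 0, ρ => rfl
  | n + 1, ρ => by
    rw [Function.iterate_succ_apply, Function.iterate_succ_apply, crStep_comap, crStep_iterate_comap G e n]

/-- **Colour refinement from a colouring**: `k` rounds from its competition ranks. [cite: MckayPiperno2014, §3.1] -/
noncomputable def colourRefine (G : SimpleGraph (Fin k)) (π : Fin k → ℕ) : Fin k → ℕ :=
  (crStep G)^[k] (rankOf π)

/-- **Colour refinement is label-invariant.** [cite: MckayPiperno2014, §3.1 (R3)] -/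
theorem colourRefine_comap (G : SimpleGraph (Fin k)) (π : Fin k → ℕ) (e : Equiv.Perm (Fin k)) :
    colourRefine (G.comap e) (π ∘ e) = colourRefine G π ∘ e := by
  rw [colourRefine, colourRefine, rankOf_comp_equiv, crStep_iterate_comap]

/-- **Individualization** of `v`: `v` gets colour `0`, every other colour is shifted up by one.
[cite: MckayPiperno2014, §2.3 ("giving the vertices in the sequence unique colours")] -/
def individualize (π : Fin k → ℕ) (v : Fin k) : Fin k → ℕ := fun w => if w = v then 0 else π w + 1

/-- Individualization is label-invariant. [folklore] -/
theorem individualize_comp (π : Fin k → ℕ) (e : Equiv.Perm (Fin k)) (v : Fin k) :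
    individualize (π ∘ e) (e.symm v) = individualize π v ∘ e := by
  funext w
  simp only [individualize, Function.comp_apply, ← Equiv.eq_symm_apply]

/-- **The refinement function** `R(G, π, ν)`: refine; then, along `ν`, individualize and refine.
[cite: MckayPiperno2014, §2.3 (refinement functions) and §3.1] -/
noncomputable def refineSeq (G : SimpleGraph (Fin k)) (π : Fin k → ℕ) (ν : List (Fin k)) : Fin k → ℕ :=
  ν.foldl (fun ρ v => colourRefine G (individualize ρ v)) (colourRefine G π)

/-- The fold of `refineSeq` is label-invariant from any start. [folklore] -/
theorem foldl_refine_comap (G : SimpleGraph (Fin k)) (e : Equiv.Perm (Fin k)) :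
    ∀ (ν : List (Fin k)) (ρ : Fin k → ℕ),
      (ν.map e.symm).foldl (fun ρ' v => colourRefine (G.comap e) (individualize ρ' v)) (ρ ∘ e) =
        ν.foldl (fun ρ' v => colourRefine G (individualize ρ' v)) ρ ∘ e
  | [], ρ => rfl
  | v :: ν, ρ => by
    rw [List.map_cons, List.foldl_cons, List.foldl_cons, individualize_comp, colourRefine_comap,
      foldl_refine_comap G e ν]

/-- **(R3): the refinement function is label-invariant**,
`R(G.comap e, π ∘ e, ν.map e⁻¹) = R(G, π, ν) ∘ e`. [cite: MckayPiperno2014, §2.3 (R3) and §3.1] -/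
theorem refineSeq_comap (G : SimpleGraph (Fin k)) (π : Fin k → ℕ) (ν : List (Fin k)) (e : Equiv.Perm (Fin k)) :
    refineSeq (G.comap e) (π ∘ e) (ν.map e.symm) = refineSeq G π ν ∘ e := by
  rw [refineSeq, refineSeq, colourRefine_comap, foldl_refine_comap]

/-! ### Singleton cells persist -/

/-- `v` is alone in its colour class. [folklore] -/
def IsSingletonColour (ρ : Fin k → ℕ) (v : Fin k) : Prop := ∀ w, ρ w = ρ v → w = v

/-- Singleton cells under relabelling. [folklore] -/
theorem isSingletonColour_comp {ρ : Fin k → ℕ} {e : Equiv.Perm (Fin k)} {v : Fin k} :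
    IsSingletonColour (ρ ∘ e) v ↔ IsSingletonColour ρ (e v) := by
  constructor
  · intro h w hw
    have := h (e.symm w) (by simpa using hw)
    rw [← this, Equiv.apply_symm_apply]
  · intro h w hw
    exact e.injective (h (e w) hw)

/-- Competition ranking keeps singleton cells. [folklore] -/
theorem isSingletonColour_rankOf {α : Type} [LinearOrder α] {f : Fin k → α} {v : Fin k}
    (h : ∀ w, f w = f v → w = v) : IsSingletonColour (rankOf f) v :=
  fun w hw => h w ((rankOf_eq_iff f).1 hw)

/-- A refinement round keeps singleton cells (keys record the old colour, `eq_of_ocrStep_eq`). [folklore] -/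
theorem isSingletonColour_crStep (G : SimpleGraph (Fin k)) {ρ : Fin k → ℕ} {v : Fin k}
    (h : IsSingletonColour ρ v) : IsSingletonColour (crStep G ρ) v :=
  fun w hw => h w (eq_of_ocrStep_eq hw)

/-- Iterated rounds keep singleton cells. [folklore] -/
theorem isSingletonColour_crStep_iterate (G : SimpleGraph (Fin k)) {v : Fin k} :
    ∀ (n : ℕ) {ρ : Fin k → ℕ}, IsSingletonColour ρ v → IsSingletonColour ((crStep G)^[n] ρ) v
  | 0, _, h => h
  | n + 1, _, h => by
    rw [Function.iterate_succ_apply]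
    exact isSingletonColour_crStep_iterate G n (isSingletonColour_crStep G h)

/-- Colour refinement keeps singleton cells. [folklore] -/
theorem isSingletonColour_colourRefine (G : SimpleGraph (Fin k)) {ρ : Fin k → ℕ} {v : Fin k}
    (h : IsSingletonColour ρ v) : IsSingletonColour (colourRefine G ρ) v :=
  isSingletonColour_crStep_iterate G k (isSingletonColour_rankOf h)

/-- The individualized vertex is a singleton cell. [folklore] -/
theorem isSingletonColour_individualize_self (ρ : Fin k → ℕ) (v : Fin k) :
    IsSingletonColour (individualize ρ v) v := by
  intro w hw
  by_contra hne
  simp [individualize, hne] at hw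

/-- Individualization keeps singleton cells. [folklore] -/
theorem isSingletonColour_individualize_of {ρ : Fin k → ℕ} {u : Fin k} (h : IsSingletonColour ρ u) (v : Fin k) :
    IsSingletonColour (individualize ρ v) u := by
  intro w hw
  unfold individualize at hw
  by_cases hwv : w = v <;> by_cases huv : u = v
  · rw [hwv, huv]
  · rw [if_pos hwv, if_neg huv] at hw
    exact absurd hw (by omega)
  · rw [if_neg hwv, if_pos huv] at hw
    exact absurd hw (by omega)
  · rw [if_neg hwv, if_neg huv, Nat.add_right_cancel_iff] at hw
    exact h w hw

/-- Along the fold, the vertices already individualized stay singleton cells. [folklore] -/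
theorem isSingletonColour_foldl (G : SimpleGraph (Fin k)) :
    ∀ (ν : List (Fin k)) (ρ : Fin k → ℕ) (A : List (Fin k)), (∀ u ∈ A, IsSingletonColour ρ u) →
      ∀ u ∈ A ++ ν, IsSingletonColour (ν.foldl (fun ρ' v => colourRefine G (individualize ρ' v)) ρ) u
  | [], ρ, A, hA, u, hu => by
    rw [List.append_nil] at hu
    exact hA u hu
  | v :: ν, ρ, A, hA, u, hu => by
    rw [List.foldl_cons]
    refine isSingletonColour_foldl G ν _ (A ++ [v]) (fun w hw => ?_) u (by simpa using hu)
    rw [List.mem_append, List.mem_singleton] at hw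
    rcases hw with hw | rfl
    · exact isSingletonColour_colourRefine G (isSingletonColour_individualize_of (hA w hw) v)
    · exact isSingletonColour_colourRefine G (isSingletonColour_individualize_self ρ w)

/-- **(R2): the vertices of `ν` are singleton cells of `R(G, π, ν)`.** [cite: MckayPiperno2014, §2.3 (R2)] -/
theorem isSingletonColour_refineSeq (G : SimpleGraph (Fin k)) (π : Fin k → ℕ) (ν : List (Fin k)) {v : Fin k}
    (hv : v ∈ ν) : IsSingletonColour (refineSeq G π ν) v :=
  isSingletonColour_foldl G ν (colourRefine G π) [] (fun _ h => absurd h List.not_mem_nil) v (by simpa using hv)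

/-! ### The target cell: the least-coloured non-singleton cell -/

/-- The vertices in non-singleton cells. [folklore] -/
noncomputable def bigSet (ρ : Fin k → ℕ) : Finset (Fin k) :=
  Finset.univ.filter fun w => ¬ IsSingletonColour ρ w

/-- **The target cell** of a colouring: the vertices whose colour is the least colour of a
non-singleton cell (empty when the colouring is discrete: then that least colour is `⊤`).
[cite: MckayPiperno2014, §3.2 (target cell selection)] -/
noncomputable def targetOf (ρ : Fin k → ℕ) : Finset (Fin k) :=
  Finset.univ.filter fun w => ((bigSet ρ).image ρ).min = WithTop.some (ρ w)

/-- The non-singleton vertices under relabelling. [folklore] -/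
theorem bigSet_comp (ρ : Fin k → ℕ) (e : Equiv.Perm (Fin k)) : bigSet (ρ ∘ e) = (bigSet ρ).image e.symm := by
  ext w
  simp only [bigSet, Finset.mem_filter, Finset.mem_univ, true_and, Finset.mem_image, isSingletonColour_comp]
  constructor
  · exact fun h => ⟨e w, h, e.symm_apply_apply w⟩
  · rintro ⟨w', h, rfl⟩
    simpa using h

/-- The colours of the non-singleton cells are label-invariant. [folklore] -/
theorem image_bigSet_comp (ρ : Fin k → ℕ) (e : Equiv.Perm (Fin k)) :
    (bigSet (ρ ∘ e)).image (ρ ∘ e) = (bigSet ρ).image ρ := by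
  rw [bigSet_comp, Finset.image_image]
  exact Finset.image_congr fun w _ => by simp

/-- **(T3): the target cell is label-invariant.** [cite: MckayPiperno2014, §2.3 (T3)] -/
theorem targetOf_comp (ρ : Fin k → ℕ) (e : Equiv.Perm (Fin k)) : targetOf (ρ ∘ e) = (targetOf ρ).image e.symm := by
  ext w
  simp only [targetOf, Finset.mem_filter, Finset.mem_univ, true_and, Finset.mem_image, image_bigSet_comp,
    Function.comp_apply]
  constructor
  · exact fun h => ⟨e w, h, e.symm_apply_apply w⟩
  · rintro ⟨w', h, rfl⟩
    simpa using h

/-- Members of the target cell lie in non-singleton cells. [folklore] -/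
theorem not_isSingletonColour_of_mem_targetOf {ρ : Fin k → ℕ} {w : Fin k} (hw : w ∈ targetOf ρ) :
    ¬ IsSingletonColour ρ w := by
  intro hs
  rw [targetOf, Finset.mem_filter] at hw
  obtain ⟨u, hu, huw⟩ := Finset.mem_image.1 (Finset.mem_of_min hw.2)
  rw [bigSet, Finset.mem_filter] at hu
  exact hu.2 (hs u huw ▸ hs)

/-- **(T1)–(T2): the target cell is empty exactly at discrete colourings.** [cite: MckayPiperno2014, §2.3 (T1)–(T2)] -/
theorem targetOf_eq_empty_iff (ρ : Fin k → ℕ) : targetOf ρ = ∅ ↔ Function.Injective ρ := by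
  constructor
  · intro h
    by_contra hinj
    obtain ⟨a, b, hab, hne⟩ := Function.not_injective_iff.1 hinj
    have ha : a ∈ bigSet ρ := by
      rw [bigSet, Finset.mem_filter]
      exact ⟨Finset.mem_univ _, fun hs => hne (hs b hab.symm).symm⟩
    obtain ⟨m, hm⟩ := Finset.min_of_mem (Finset.mem_image_of_mem ρ ha)
    obtain ⟨u, -, hum⟩ := Finset.mem_image.1 (Finset.mem_of_min hm)
    have : u ∈ targetOf ρ := by
      rw [targetOf, Finset.mem_filter]
      exact ⟨Finset.mem_univ _, by rw [hm, hum]⟩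
    rw [h] at this
    exact Finset.notMem_empty _ this
  · intro hinj
    have hb : bigSet ρ = ∅ := by
      refine Finset.eq_empty_of_forall_notMem fun w hw => ?_
      rw [bigSet, Finset.mem_filter] at hw
      exact hw.2 fun u hu => hinj hu
    refine Finset.eq_empty_of_forall_notMem fun w hw => ?_
    rw [targetOf, Finset.mem_filter, hb, Finset.image_empty, Finset.min_empty] at hw
    exact WithTop.top_ne_coe hw.2

/-! ### The scheme -/

/-- **The plain individualization–refinement scheme**: `R = refineSeq` (ordered colour refinement
with individualization along `ν`), `T` = the least-coloured non-singleton cell of `R(G, π, ν)`;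
all four laws of `IRScheme` hold. [cite: MckayPiperno2014, §2.3 and §3.1–3.2] -/
noncomputable def crScheme (k : ℕ) : IRScheme k where
  refine G π ν := refineSeq G π ν
  target G π ν := targetOf (refineSeq G π ν)
  refine_comap G π ν e := refineSeq_comap G π ν e
  target_comap G π ν e := by
    show targetOf (refineSeq (G.comap e) (π ∘ e) (ν.map e.symm)) = (targetOf (refineSeq G π ν)).image e.symm
    rw [refineSeq_comap, targetOf_comp]
  target_eq_empty_iff G π ν := targetOf_eq_empty_iff _
  not_mem_of_mem_target G π ν w hw hmem :=
    not_isSingletonColour_of_mem_targetOf hw (isSingletonColour_refineSeq G π ν hmem)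

/-- Hence the leaf labelings of the plain scheme form a nonempty, equivariant labeling set (so the
lexicographic leader over them is a canonical form, `leader_isCanonicalForm`). [cite: MckayPiperno2014, Lemma 1 and Lemma 4] -/
theorem crScheme_isLabelingSet :
    (∀ (k : ℕ) (G : SimpleGraph (Fin k)) (col : Fin k → ℕ), ((crScheme k).leafLabelings G col).Nonempty) ∧
    ∀ (k : ℕ) (G₁ : SimpleGraph (Fin k)) (c₁ : Fin k → ℕ) (G₂ : SimpleGraph (Fin k)) (c₂ : Fin k → ℕ)
      (σ : G₁ ≃g G₂), (∀ v, c₂ (σ v) = c₁ v) →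
        (crScheme k).leafLabelings G₂ c₂ = ((crScheme k).leafLabelings G₁ c₁).image fun e => e.trans σ.toEquiv :=
  IRScheme.leafLabelings_isLabelingSet crScheme

end ColourRefinementScheme

end Literature.Computability.Complexity
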